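import Literature.Analysis.FluidPDE.HardSphereDynamicsProofs
import Literature.Analysis.FluidPDE.BBGKYMarginals
import Literature.Analysis.FunctionSpaces.FlatTorus
import HarnessLib

/-!
# Separated free flights are hard-sphere trajectories: on BGSR's good configurations the
# hard-sphere transport is the free flow
(Bodineau–Gallagher–Saint-Raymond, Invent. Math. 203 (2016) = arXiv:1305.3397v2, §5.2.1 "The
elementary step", p. 16 of the held text; Gallagher–Saint-Raymond–Texier 2013 §12; trunk T-KINETIC,
topic Analysis/FluidPDE (hard-sphere dynamics); a brick of layer M3 (coupling of the BBGKY and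
Boltzmann pseudo-trajectories, BGSR Props. 5.1 and 5.3) of the bottom-up proof plan of the named
fact `Literature.MathematicalPhysics.KineticTheory.bgsr_theorem22` / fact (c)
`bodineau_gallagher_saintRaymond_linear(_alpha)` recorded in
`Literature/MathematicalPhysics/KineticTheory/TaggedSphereLinearBoltzmann.lean`.)

BGSR §5.2.1 (p. 16): *"The set of good configurations with `k` particles will be such that the
particles remain at a distance `ε₀ ≫ ε` for a time `t`, i.e. that they belong to the set
`𝒢_k(ε₀) := {Z_k ∈ T^{dk} × ℝ^{dk} | ∀ u ∈ [0, t], ∀ i ≠ j, d(x_i - u v_i, x_j - u v_j) ≥ ε₀}`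
where `d` denotes the distance on the torus `T^d`. For particles in `𝒢_k(ε₀)`, the transport `Ψ_k`
coincides with the free flow."* (`Ψ_k` is the backward `k`-particle hard-sphere flow, p. 15.) The
same mechanism is used in the proof of Proposition 5.3 (p. 18: "Proposition 5.1 implies that
backwards in time, there is free flow for `Z_{i+1}`", (5.14)) in the form: *if along the backward
free flight no two particles come at distance `ε`, the hard-sphere pseudo-trajectory is the free
one.*

This file PROVES these deterministic statements for the accepted hard-sphere dynamics of
`Literature.Analysis.FluidPDE.HardSphereDynamics` (`IsHardSphereTrajectory`, and the hypothesis
structure `HardSphereFlow` = any realisation of Alexander's flow), in any geometry with continuous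
translations over a Hausdorff position space (both `T^d` and `ℝ^d`):

* `IsHardSphereTrajectory.not_mem_collisionTimes_of_freeFlight_ne`,
  `IsHardSphereTrajectory.eq_freeFlight_of_freeFlight_ne` — **forward, trajectory level**: if the
  free flight issued from `γ t₀` has no pair at distance exactly `ε` at any time of `(t₀, t₁]`,
  then `γ` has no collision in `(t₀, t₁]` and is that free flight on `[t₀, t₁]` (the first
  collision time after `t₀` would be reached by free flight with continuous positions, hence
  would put a pair of the free flight at distance `ε`).
* `HardSphereFlow.flow_eq_freeFlight_of_freeFlight_ne` — the same for the orbit `u ↦ Φ_u z` of a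
  good point.
* `HardSphereFlow.flow_neg_eq_freeFlight_of_freeFlight_ne` — **backward** (the form BGSR use):
  if the backward free flight `u ↦ S⁰_{-u} z`, `u ∈ [0, t)`, has no pair at distance `ε`, then
  `Φ_{-u} z = S⁰_{-u} z` for all `u ∈ [0, t]` (the last collision time of the orbit of `Φ_{-u} z`
  before it reaches `z` would be a contact configuration on the backward free flight of `z`).
* `bgsrGoodConfigs G k ε₀ t` — BGSR's `𝒢_k(ε₀)` (definition, with its elementary API:
  antitonicity in `ε₀` and `t`, inclusion in the hard-sphere domain `D_ε^k` for `ε ≤ ε₀`,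
  stability under the backward free flight), and
  `HardSphereFlow.flow_neg_eq_freeFlight_of_mem_bgsrGoodConfigs`,
  `hsTransport_eq_freeTransport_of_mem_bgsrGoodConfigs` — **"for particles in `𝒢_k(ε₀)` the
  transport `Ψ_k` coincides with the free flow"**: for `ε < ε₀`, on `𝒢_k(ε₀) ∩ Φ.good` the
  hard-sphere transport `hsTransport Φ u` of the BBGKY hierarchy (`BBGKYMarginals`) equals the free
  transport `freeTransport G k u` of the Boltzmann hierarchy for all `u ∈ [0, t]`.
* `Torus.continuous_geometry_translate` — the flat torus satisfies the continuity hypothesis.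

## Design choices

* The separation hypothesis is stated in its minimal form `‖x_i(u) - x_j(u)‖ ≠ ε` (a collision
  time is a time of *contact*, `Kinetic.collisionTimes`); the corollaries for `𝒢_k(ε₀)` use
  `ε < ε₀ ≤ ‖·‖`.
* Statements about flows are relative to the good set `Φ.good` (off it `HardSphereFlow.flow` is
  junk); `𝒢_k(ε₀)` itself is a condition on the free flight only, as printed.
* Hypotheses: `[T2Space X]` (positions of the trajectory and of the free flight are both limits
  from the left at the first collision time) and continuity of each translation
  `v ↦ G.translate x v` (so that free flights are continuous in time), exactly as in the trajectory
  lemmas of `HardSphereDynamicsProofs`; `Geometry.IsHardSphereRegular.continuous_translate_left`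
  (`HardSphereFlowGroup`) and `Torus.continuous_geometry_translate` below provide the latter.

## References

* T. Bodineau, I. Gallagher, L. Saint-Raymond, *The Brownian motion as the limit of a
  deterministic system of hard-spheres*, Invent. Math. 203 (2016) 493–553 = arXiv:1305.3397v2,
  §5.1 (p. 15), §5.2.1 (p. 16: `𝒢_k(ε₀)`), proof of Prop. 5.3 (p. 18, (5.14)).
* I. Gallagher, L. Saint-Raymond, B. Texier, *From Newton to Boltzmann: hard spheres and
  short-range potentials*, EMS (2013), Def. 12.2.1 (good configurations), §4.1.
-/

open MeasureTheory Set Filter Topology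

namespace Literature.Analysis.FluidPDE

noncomputable section

section Kinetic

variable {d : Type*} [Fintype d] {X : Type*} {N : ℕ}

/-! ## Forward: a trajectory whose free flight stays off contact is that free flight -/

namespace IsHardSphereTrajectory

variable [TopologicalSpace X] {G : Geometry d X} {ε : ℝ} {γ : ℝ → Config N d X}

/-- At a time `τ > t₀` preceded by a collision-free interval `(t₀, τ)`, the positions of the
trajectory are those of the free flight issued from `γ t₀` (positions are continuous, the
trajectory is the free flight on `[t₀, τ)`). [folklore] -/
theorem apply_fst_eq_freeFlight_of_Ioo_free [T2Space X] (h : IsHardSphereTrajectory G ε N γ)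
    (hG : ∀ x : X, Continuous (G.translate x)) {t₀ τ : ℝ} (hτ : t₀ < τ)
    (hfree : ∀ σ ∈ Ioo t₀ τ, σ ∉ collisionTimes G ε γ) (k : Fin N) :
    (γ τ k).1 = (freeFlight G (τ - t₀) (γ t₀) k).1 := by
  have hev : Continuous fun z : Config N d X => (z k).1 := by fun_prop
  have h1 : Tendsto (fun σ => (γ σ k).1) (𝓝[<] τ) (𝓝 (freeFlight G (τ - t₀) (γ t₀) k).1) :=
    (hev.tendsto _).comp (h.tendsto_nhdsLT hG hτ hfree)
  have h2 : Tendsto (fun σ => (γ σ k).1) (𝓝[<] τ) (𝓝 (γ τ k).1) :=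
    ((h.pos_continuous k).tendsto τ).mono_left nhdsWithin_le_nhds
  exact tendsto_nhds_unique h2 h1

/-- **No collision along a separated free flight.** If the free flight issued from `γ t₀` has no
pair of particles at distance exactly `ε` at any time `u ∈ (t₀, t₁]`, then the hard-sphere
trajectory `γ` has no collision time in `(t₀, t₁]`: the first one, `τ`, would be preceded by the
collision-free interval `(t₀, τ)`, so the positions of `γ τ` would be those of the free flight at
time `τ`, which are not in contact. (BGSR §5.2.1, p. 16: "For particles in `𝒢_k(ε₀)`, the transport
`Ψ_k` coincides with the free flow"; proof of Prop. 5.3, (5.14).)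
[cite: BodineauGallagherSaintRaymondInvent2016, §5.2.1, p. 16] -/
theorem not_mem_collisionTimes_of_freeFlight_ne [T2Space X] (h : IsHardSphereTrajectory G ε N γ)
    (hG : ∀ x : X, Continuous (G.translate x)) {t₀ t₁ : ℝ}
    (hsep : ∀ u ∈ Ioc t₀ t₁, ∀ i j : Fin N, i ≠ j →
      ‖G.sepVec (freeFlight G (u - t₀) (γ t₀) i).1 (freeFlight G (u - t₀) (γ t₀) j).1‖ ≠ ε) :
    ∀ u ∈ Ioc t₀ t₁, u ∉ collisionTimes G ε γ := by
  classical
  intro u hu hcol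
  -- the collision times in `(t₀, t₁]`, a finite nonempty set; `τ` its minimum
  set F : Finset ℝ := ((h.locFinite t₀ t₁).toFinset).filter fun x => t₀ < x with hF
  have hmemF : ∀ {σ : ℝ}, σ ∈ F ↔ σ ∈ collisionTimes G ε γ ∧ σ ∈ Ioc t₀ t₁ := by
    intro σ
    rw [hF, Finset.mem_filter, Set.Finite.mem_toFinset]
    exact ⟨fun ⟨⟨hc, hI⟩, hl⟩ => ⟨hc, hl, hI.2⟩, fun ⟨hc, hI⟩ => ⟨⟨hc, hI.1.le, hI.2⟩, hI.1⟩⟩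
  have huF : u ∈ F := hmemF.2 ⟨hcol, hu⟩
  have hne : F.Nonempty := ⟨u, huF⟩
  set τ := F.min' hne with hτdef
  obtain ⟨hτcol, hτI⟩ := hmemF.1 (F.min'_mem hne)
  have hfree : ∀ σ ∈ Ioo t₀ τ, σ ∉ collisionTimes G ε γ := by
    intro σ hσ hσcol
    have hσF : σ ∈ F := hmemF.2 ⟨hσcol, hσ.1, hσ.2.le.trans hτI.2⟩
    exact (not_lt.2 (F.min'_le σ hσF)) hσ.2
  -- positions at `τ` are the free-flight positions, which are in contact: contradiction
  have hpos := h.apply_fst_eq_freeFlight_of_Ioo_free hG hτI.1 hfree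
  obtain ⟨i, j, hij, hct⟩ := hτcol
  have hct' : freeFlight G (τ - t₀) (γ t₀) ∈ contactSet G N ε i j :=
    (mem_contactSet_congr_fst hpos).1 hct
  exact hsep τ hτI i j hij (mem_contactSet.1 hct').2

/-- **A separated free flight is the trajectory.** Under the hypothesis of
`not_mem_collisionTimes_of_freeFlight_ne`, `γ u = S⁰_{u - t₀} (γ t₀)` for every `u ∈ [t₀, t₁]`
(free flight on the collision-free interval `(t₀, t₁]`, field `free`).
[cite: BodineauGallagherSaintRaymondInvent2016, §5.2.1, p. 16] -/
theorem eq_freeFlight_of_freeFlight_ne [T2Space X] (h : IsHardSphereTrajectory G ε N γ)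
    (hG : ∀ x : X, Continuous (G.translate x)) {t₀ t₁ : ℝ}
    (hsep : ∀ u ∈ Ioc t₀ t₁, ∀ i j : Fin N, i ≠ j →
      ‖G.sepVec (freeFlight G (u - t₀) (γ t₀) i).1 (freeFlight G (u - t₀) (γ t₀) j).1‖ ≠ ε) :
    ∀ u ∈ Icc t₀ t₁, γ u = freeFlight G (u - t₀) (γ t₀) := fun u hu =>
  h.free t₀ u hu.1 fun σ hσ =>
    h.not_mem_collisionTimes_of_freeFlight_ne hG hsep σ ⟨hσ.1, hσ.2.trans hu.2⟩

/-- **Backward form, trajectory level.** If `γ t₁ = z` and the backward free flight of `z` has no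
pair at distance exactly `ε` at the backward times `u ∈ [0, t₁ - t₀)`, then `γ` has no collision
time in `(t₀, t₁]`: the last one, `σ`, would be followed by free flight up to `t₁`, so `γ σ` would
be the backward free flight of `z` at the backward time `t₁ - σ ∈ [0, t₁ - t₀)`, in contact.
(BGSR, proof of Prop. 5.3, p. 18: "backwards in time, there is free flow", (5.14).)
[cite: BodineauGallagherSaintRaymondInvent2016, Prop. 5.3 proof, p. 18] -/
theorem not_mem_collisionTimes_of_freeFlight_neg_ne (h : IsHardSphereTrajectory G ε N γ)
    {t₀ t₁ : ℝ} {z : Config N d X} (hz : γ t₁ = z)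
    (hsep : ∀ u ∈ Ico 0 (t₁ - t₀), ∀ i j : Fin N, i ≠ j →
      ‖G.sepVec (freeFlight G (-u) z i).1 (freeFlight G (-u) z j).1‖ ≠ ε) :
    ∀ u ∈ Ioc t₀ t₁, u ∉ collisionTimes G ε γ := by
  classical
  intro u hu hcol
  -- the collision times in `(t₀, t₁]`, a finite nonempty set; `σ` its maximum
  set F : Finset ℝ := ((h.locFinite t₀ t₁).toFinset).filter fun x => t₀ < x with hF
  have hmemF : ∀ {ρ : ℝ}, ρ ∈ F ↔ ρ ∈ collisionTimes G ε γ ∧ ρ ∈ Ioc t₀ t₁ := by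
    intro ρ
    rw [hF, Finset.mem_filter, Set.Finite.mem_toFinset]
    exact ⟨fun ⟨⟨hc, hI⟩, hl⟩ => ⟨hc, hl, hI.2⟩, fun ⟨hc, hI⟩ => ⟨⟨hc, hI.1.le, hI.2⟩, hI.1⟩⟩
  have huF : u ∈ F := hmemF.2 ⟨hcol, hu⟩
  have hne : F.Nonempty := ⟨u, huF⟩
  set σ := F.max' hne with hσdef
  obtain ⟨hσcol, hσI⟩ := hmemF.1 (F.max'_mem hne)
  have hfree : ∀ ρ ∈ Ioc σ t₁, ρ ∉ collisionTimes G ε γ := by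
    intro ρ hρ hρcol
    have hρF : ρ ∈ F := hmemF.2 ⟨hρcol, hσI.1.trans hρ.1, hρ.2⟩
    exact (not_lt.2 (F.le_max' ρ hρF)) hρ.1
  -- free flight on `(σ, t₁]`: `γ σ` is the backward free flight of `z` at time `t₁ - σ`
  have hflight : γ t₁ = freeFlight G (t₁ - σ) (γ σ) := h.free σ t₁ hσI.2 hfree
  have hback : γ σ = freeFlight G (-(t₁ - σ)) z := by
    rw [← hz, hflight, ← freeFlight_add, neg_add_cancel, freeFlight_zero]
  obtain ⟨i, j, hij, hct⟩ := hσcol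
  rw [hback] at hct
  exact hsep (t₁ - σ) ⟨sub_nonneg.2 hσI.2, by linarith [hσI.1]⟩ i j hij (mem_contactSet.1 hct).2

/-- Under the hypothesis of `not_mem_collisionTimes_of_freeFlight_neg_ne`, the trajectory is the
backward free flight of its value `z` at `t₁` on the whole of `[t₀, t₁]`:
`γ u = S⁰_{-(t₁ - u)} z`. [cite: BodineauGallagherSaintRaymondInvent2016, Prop. 5.3 proof, p. 18] -/
theorem eq_freeFlight_neg_of_freeFlight_neg_ne (h : IsHardSphereTrajectory G ε N γ)
    {t₀ t₁ : ℝ} {z : Config N d X} (hz : γ t₁ = z)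
    (hsep : ∀ u ∈ Ico 0 (t₁ - t₀), ∀ i j : Fin N, i ≠ j →
      ‖G.sepVec (freeFlight G (-u) z i).1 (freeFlight G (-u) z j).1‖ ≠ ε) :
    ∀ u ∈ Icc t₀ t₁, γ u = freeFlight G (-(t₁ - u)) z := by
  intro u hu
  have hflight : γ t₁ = freeFlight G (t₁ - u) (γ u) :=
    h.free u t₁ hu.2 fun ρ hρ =>
      h.not_mem_collisionTimes_of_freeFlight_neg_ne hz hsep ρ ⟨hu.1.trans_lt hρ.1, hρ.2⟩
  rw [← hz, hflight, ← freeFlight_add, neg_add_cancel, freeFlight_zero]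

end IsHardSphereTrajectory

/-! ## The same for hard-sphere flows -/

namespace HardSphereFlow

variable [MeasureSpace X] [TopologicalSpace X] {G : Geometry d X} {ε : ℝ}

/-- **Forward.** On a good point `z` whose free flight has no pair at distance exactly `ε` during
`(0, t]`, the hard-sphere flow is the free flight on `[0, t]`: `Φ_u z = S⁰_u z`.
[cite: BodineauGallagherSaintRaymondInvent2016, §5.2.1, p. 16] -/
theorem flow_eq_freeFlight_of_freeFlight_ne [T2Space X] (Φ : HardSphereFlow G ε N)
    (hG : ∀ x : X, Continuous (G.translate x)) {z : Config N d X} (hz : z ∈ Φ.good) {t : ℝ}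
    (hsep : ∀ u ∈ Ioc 0 t, ∀ i j : Fin N, i ≠ j →
      ‖G.sepVec (freeFlight G u z i).1 (freeFlight G u z j).1‖ ≠ ε) :
    ∀ u ∈ Icc 0 t, Φ.flow u z = freeFlight G u z := by
  intro u hu
  have htraj := Φ.isTrajectory z hz
  have h0 : (fun s => Φ.flow s z) 0 = z := Φ.flow_zero z hz
  have key := htraj.eq_freeFlight_of_freeFlight_ne hG (t₀ := 0) (t₁ := t) (by
    intro u hu i j hij
    simpa only [h0, sub_zero] using hsep u hu i j hij) u hu
  simpa only [h0, sub_zero] using key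

/-- **Backward** (the form used for the pseudo-trajectories of the BBGKY hierarchy, which are
followed backwards, BGSR §5.1). On a good point `z` whose backward free flight has no pair at
distance exactly `ε` at the backward times `u ∈ [0, t)`, the backward hard-sphere flow is the
backward free flight on `[0, t]`: `Φ_{-u} z = S⁰_{-u} z`. Proof: `w := Φ_{-u} z` is good and its
orbit reaches `z` at time `u` (group law on the good set); apply the trajectory-level statement
`IsHardSphereTrajectory.eq_freeFlight_neg_of_freeFlight_neg_ne` on `[0, u]`.
[cite: BodineauGallagherSaintRaymondInvent2016, Prop. 5.3 proof, p. 18] -/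
theorem flow_neg_eq_freeFlight_of_freeFlight_ne (Φ : HardSphereFlow G ε N) {z : Config N d X}
    (hz : z ∈ Φ.good) {t : ℝ}
    (hsep : ∀ u ∈ Ico 0 t, ∀ i j : Fin N, i ≠ j →
      ‖G.sepVec (freeFlight G (-u) z i).1 (freeFlight G (-u) z j).1‖ ≠ ε) :
    ∀ u ∈ Icc 0 t, Φ.flow (-u) z = freeFlight G (-u) z := by
  intro u hu
  set w := Φ.flow (-u) z with hw
  have hwgood : w ∈ Φ.good := Φ.mapsTo_good (-u) hz
  have htraj := Φ.isTrajectory w hwgood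
  have hreach : (fun s => Φ.flow s w) u = z := by
    change Φ.flow u (Φ.flow (-u) z) = z
    rw [← Φ.flow_add u (-u) z hz, add_neg_cancel, Φ.flow_zero z hz]
  have key := htraj.eq_freeFlight_neg_of_freeFlight_neg_ne (t₀ := 0) (t₁ := u) hreach (by
    intro u' hu' i j hij
    exact hsep u' ⟨hu'.1, by linarith [hu'.2, hu.2, sub_zero u]⟩ i j hij) 0 ⟨le_rfl, hu.1⟩
  have h0 : Φ.flow 0 w = w := Φ.flow_zero w hwgood
  rw [h0, sub_zero] at key
  exact key

end HardSphereFlow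

/-! ## BGSR's good configurations `𝒢_k(ε₀)` -/

section Good

variable (G : Geometry d X)

/-- BGSR's set `𝒢_k(ε₀)` of *good configurations* of `k` particles relative to the time `t`
(§5.2.1, p. 16; GST 2013 Def. 12.2.1): along the backward free flight every pair stays at
distance at least `ε₀` during `[0, t]`,
`𝒢_k(ε₀) := {Z_k | ∀ u ∈ [0, t], ∀ i ≠ j, d(x_i - u v_i, x_j - u v_j) ≥ ε₀}`
(`d` = the distance of the geometry, the minimal-image distance `‖G.sepVec · ·‖` on `T^d`).
[cite: BodineauGallagherSaintRaymondInvent2016, §5.2.1, p. 16] -/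
def bgsrGoodConfigs (k : ℕ) (ε₀ t : ℝ) : Set (Config k d X) :=
  {Z | ∀ u ∈ Icc (0 : ℝ) t, ∀ i j : Fin k, i ≠ j →
    ε₀ ≤ ‖G.sepVec (freeFlight G (-u) Z i).1 (freeFlight G (-u) Z j).1‖}

variable {G} {k : ℕ} {ε₀ ε₀' t t' : ℝ}

/-- Membership in `𝒢_k(ε₀)`. [folklore] -/
theorem mem_bgsrGoodConfigs_iff {Z : Config k d X} :
    Z ∈ bgsrGoodConfigs G k ε₀ t ↔ ∀ u ∈ Icc (0 : ℝ) t, ∀ i j : Fin k, i ≠ j →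
      ε₀ ≤ ‖G.sepVec (freeFlight G (-u) Z i).1 (freeFlight G (-u) Z j).1‖ :=
  Iff.rfl

/-- `𝒢_k` is antitone in the separation: `𝒢_k(ε₀') ⊆ 𝒢_k(ε₀)` for `ε₀ ≤ ε₀'` (BGSR use
`𝒢_{k+1}(ε₀/2) ⊇ 𝒢_{k+1}(ε₀)`, (5.8)). [folklore] -/
theorem bgsrGoodConfigs_anti (h : ε₀ ≤ ε₀') : bgsrGoodConfigs G k ε₀' t ⊆ bgsrGoodConfigs G k ε₀ t :=
  fun _ hZ u hu i j hij => h.trans (hZ u hu i j hij)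

/-- `𝒢_k` is antitone in the time horizon. [folklore] -/
theorem bgsrGoodConfigs_anti_time (h : t ≤ t') :
    bgsrGoodConfigs G k ε₀ t' ⊆ bgsrGoodConfigs G k ε₀ t :=
  fun _ hZ u hu i j hij => hZ u ⟨hu.1, hu.2.trans h⟩ i j hij

/-- Good configurations lie in the hard-sphere domain `D_ε^k` as soon as `ε ≤ ε₀` (time `u = 0`).
[folklore] -/
theorem bgsrGoodConfigs_subset_hardSphereDomain (ht : 0 ≤ t) {ε : ℝ} (hε : ε ≤ ε₀) :
    bgsrGoodConfigs G k ε₀ t ⊆ hardSphereDomain G k ε := by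
  intro Z hZ i j hij
  have h0 := hZ 0 ⟨le_rfl, ht⟩ i j hij
  simp only [neg_zero, freeFlight_zero] at h0
  exact hε.trans h0

/-- Stability under the backward free flight: if `Z ∈ 𝒢_k(ε₀)` relative to the time `t` and
`s ∈ [0, t]`, then `S⁰_{-s} Z ∈ 𝒢_k(ε₀)` relative to the remaining time `t - s`. [folklore] -/
theorem freeFlight_neg_mem_bgsrGoodConfigs {Z : Config k d X} (hZ : Z ∈ bgsrGoodConfigs G k ε₀ t)
    {s : ℝ} (hs : s ∈ Icc 0 t) : freeFlight G (-s) Z ∈ bgsrGoodConfigs G k ε₀ (t - s) := by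
  intro u hu i j hij
  have h := hZ (u + s) ⟨add_nonneg hu.1 hs.1, by linarith [hu.2]⟩ i j hij
  rwa [neg_add, freeFlight_add] at h

/-- On `𝒢_k(ε₀)` with `ε < ε₀`, the backward free flight never puts a pair at distance `ε` during
`[0, t]`. [folklore] -/
theorem norm_sepVec_freeFlight_ne_of_mem_bgsrGoodConfigs {Z : Config k d X}
    (hZ : Z ∈ bgsrGoodConfigs G k ε₀ t) {ε : ℝ} (hε : ε < ε₀) :
    ∀ u ∈ Icc (0 : ℝ) t, ∀ i j : Fin k, i ≠ j →
      ‖G.sepVec (freeFlight G (-u) Z i).1 (freeFlight G (-u) Z j).1‖ ≠ ε :=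
  fun u hu i j hij => (hε.trans_le (hZ u hu i j hij)).ne'

variable [MeasureSpace X] [TopologicalSpace X] {ε : ℝ}

/-- **"For particles in `𝒢_k(ε₀)`, the transport `Ψ_k` coincides with the free flow"** (BGSR
§5.2.1, p. 16), flow form: for `ε < ε₀` and a good point `Z ∈ 𝒢_k(ε₀)` of a hard-sphere flow `Φ`
of `k` spheres of diameter `ε`, `Φ_{-u} Z = S⁰_{-u} Z` for all `u ∈ [0, t]`.
[cite: BodineauGallagherSaintRaymondInvent2016, §5.2.1, p. 16] -/
theorem HardSphereFlow.flow_neg_eq_freeFlight_of_mem_bgsrGoodConfigs (Φ : HardSphereFlow G ε k)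
    (hε : ε < ε₀) {Z : Config k d X} (hZ : Z ∈ bgsrGoodConfigs G k ε₀ t) (hgood : Z ∈ Φ.good) :
    ∀ u ∈ Icc (0 : ℝ) t, Φ.flow (-u) Z = freeFlight G (-u) Z :=
  Φ.flow_neg_eq_freeFlight_of_freeFlight_ne hgood fun u hu i j hij =>
    norm_sepVec_freeFlight_ne_of_mem_bgsrGoodConfigs hZ hε u (Ico_subset_Icc_self hu) i j hij

/-- **"For particles in `𝒢_k(ε₀)`, the transport `Ψ_k` coincides with the free flow"** (BGSR
§5.2.1, p. 16), transport form: for `ε < ε₀`, on `𝒢_k(ε₀) ∩ Φ.good` the hard-sphere transport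
`T^ε_k(u) g = g ∘ Φ_{-u}` of the BBGKY hierarchy (`Kinetic.hsTransport`, GST 2013 (4.3.7)) equals
the free transport `T⁰_k(u) g = g ∘ S⁰_{-u}` of the Boltzmann hierarchy (`Kinetic.freeTransport`)
for every `u ∈ [0, t]` and every `g`. [cite: BodineauGallagherSaintRaymondInvent2016, §5.2.1, p. 16] -/
theorem hsTransport_eq_freeTransport_of_mem_bgsrGoodConfigs (Φ : HardSphereFlow G ε k)
    (hε : ε < ε₀) {Z : Config k d X} (hZ : Z ∈ bgsrGoodConfigs G k ε₀ t) (hgood : Z ∈ Φ.good)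
    (g : Config k d X → ℝ) : ∀ u ∈ Icc (0 : ℝ) t, hsTransport Φ u g Z = freeTransport G k u g Z := by
  intro u hu
  rw [hsTransport_apply, freeTransport_apply,
    Φ.flow_neg_eq_freeFlight_of_mem_bgsrGoodConfigs hε hZ hgood u hu]

end Good

end Kinetic

/-! ## The flat torus satisfies the continuity hypothesis -/

/-- On the flat torus each translation `v ↦ x + proj v` of `Torus.geometry d` is continuous (the
hypothesis `hG` of the forward statements; for `ε < 1/2` this is also
`(Torus.isHardSphereRegular_geometry hε).continuous_translate_left`). [folklore] -/
theorem Torus.continuous_geometry_translate {d : Type*} [Fintype d] (x : UnitAddTorus d) :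
    Continuous ((Torus.geometry d).translate x) := by
  change Continuous fun v : EuclideanSpace ℝ d => x + FunctionSpaces.Torus.proj v
  exact continuous_const.add FunctionSpaces.Torus.continuous_proj

end

end Literature.Analysis.FluidPDE
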